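import Summits.PneNP.PneNP.Theses.AperiodicTorus

/-!
# Route AperiodicTorus — `InvariantPairLaw` (stmt-PneNP-2473)

If the tile set `τ` tiles the plane (`f : ℤ → ℤ → Fin t` with matching colours) then there are a probability vector `μ` on
tiles and nonnegative pair laws `ρh`, `ρv`, supported on horizontally resp. vertically matching pairs, all of whose
marginals equal `μ`: ONE translation-invariant feasible point of the basic LP relaxation, for every torus size at once.

Proof (card S1/D1). For the window `[0,N)²` let `μ_N`, `ρh_N`, `ρv_N` be the empirical frequencies of tiles, of
horizontal pairs `(f i j, f i (j+1))` and of vertical pairs `(f i j, f (i+1) j)`. The first marginals are exact, the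
second marginals are off by at most `N/N² = 1/N` (telescoping along a row or column), the supports are matching pairs
by the tiling condition, and everything lives in `[0,1]`. A convergent subsequence (Bolzano–Weierstrass in the finite
dimensional space of laws) gives the invariant triple. [JeandelVanier2020, Prop. 6 (same compactness)]
-/

set_option linter.dupNamespace false -- `Summit.PneNP.PneNP.…`: summit = sub-problem name (D-0017 single-conjunct layout)

namespace Summit.PneNP.PneNP.Theorems

open Filter Topology

/-- Telescoping bound: shifting the second index of a `[0,1]`-valued array by one changes the window sum over `[0,N)²`
by at most `N`. [folklore] -/
theorem abs_sum_range_shift_sub_le (N : ℕ) (G : ℕ → ℕ → ℝ) (hG : ∀ a b, 0 ≤ G a b ∧ G a b ≤ 1) :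
    |∑ a ∈ Finset.range N, ∑ b ∈ Finset.range N, G a (b + 1) -
        ∑ a ∈ Finset.range N, ∑ b ∈ Finset.range N, G a b| ≤ N := by
  rw [← Finset.sum_sub_distrib]
  refine (Finset.abs_sum_le_sum_abs _ _).trans ?_
  have hterm : ∀ a ∈ Finset.range N,
      |∑ b ∈ Finset.range N, G a (b + 1) - ∑ b ∈ Finset.range N, G a b| ≤ 1 := by
    intro a _
    have t1 := Finset.sum_range_succ' (G a) N
    have t2 := Finset.sum_range_succ (G a) N
    have h0 := hG a 0
    have hN := hG a N
    rw [abs_le]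
    constructor <;> linarith
  refine (Finset.sum_le_sum hterm).trans ?_
  simp

/-- **Support item `InvariantPairLaw` of route AperiodicTorus (stmt-PneNP-2473)**: a tile set that tiles the plane
admits a translation-invariant pair law — a probability vector `μ` on tiles and nonnegative horizontal / vertical pair
laws supported on matching pairs with all four marginals equal to `μ` (limit of window frequencies along a convergent
subsequence). Hence no plane-tiling `T` is refuted by the basic LP / arc-consistency relaxation of any torus.
[cite: JeandelVanier2020, Prop. 6] -/
theorem aperiodicTorus_invariantPairLaw_proof : Summit.PneNP.PneNP.Theses.AperiodicTorus.InvariantPairLaw := by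
  unfold Summit.PneNP.PneNP.Theses.AperiodicTorus.InvariantPairLaw
  rintro t τ ⟨f, hf⟩
  classical
  -- window counts
  let cμ : ℕ → Fin t → ℝ := fun N s =>
    ∑ i ∈ Finset.range N, ∑ j ∈ Finset.range N, (if f i j = s then (1 : ℝ) else 0)
  let ch : ℕ → Fin t → Fin t → ℝ := fun N s s' =>
    ∑ i ∈ Finset.range N, ∑ j ∈ Finset.range N, (if f i j = s ∧ f i (j + 1) = s' then (1 : ℝ) else 0)
  let cv : ℕ → Fin t → Fin t → ℝ := fun N s s' =>
    ∑ i ∈ Finset.range N, ∑ j ∈ Finset.range N, (if f i j = s ∧ f (i + 1) j = s' then (1 : ℝ) else 0)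
  -- total mass
  have hsumμ : ∀ N, ∑ s, cμ N s = (N : ℝ) ^ 2 := by
    intro N
    simp only [cμ]
    rw [Finset.sum_comm]
    have hin : ∀ i ∈ Finset.range N,
        ∑ s : Fin t, ∑ j ∈ Finset.range N, (if f i j = s then (1 : ℝ) else 0) = N := by
      intro i _
      rw [Finset.sum_comm]
      simp
    rw [Finset.sum_congr rfl hin]
    simp [sq]
  -- nonnegativity
  have hμnn : ∀ N s, 0 ≤ cμ N s := fun N s =>
    Finset.sum_nonneg fun i _ => Finset.sum_nonneg fun j _ => by split_ifs <;> norm_num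
  have hhnn : ∀ N s s', 0 ≤ ch N s s' := fun N s s' =>
    Finset.sum_nonneg fun i _ => Finset.sum_nonneg fun j _ => by split_ifs <;> norm_num
  have hvnn : ∀ N s s', 0 ≤ cv N s s' := fun N s s' =>
    Finset.sum_nonneg fun i _ => Finset.sum_nonneg fun j _ => by split_ifs <;> norm_num
  -- exact first marginals
  have hrow : ∀ N s, ∑ s', ch N s s' = cμ N s := by
    intro N s
    simp only [ch, cμ]
    rw [Finset.sum_comm]
    refine Finset.sum_congr rfl fun i _ => ?_
    rw [Finset.sum_comm]
    refine Finset.sum_congr rfl fun j _ => ?_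
    by_cases h : f i j = s <;> simp [h]
  have hrowv : ∀ N s, ∑ s', cv N s s' = cμ N s := by
    intro N s
    simp only [cv, cμ]
    rw [Finset.sum_comm]
    refine Finset.sum_congr rfl fun i _ => ?_
    rw [Finset.sum_comm]
    refine Finset.sum_congr rfl fun j _ => ?_
    by_cases h : f i j = s <;> simp [h]
  -- approximate second marginals
  have hcol : ∀ N s, |∑ s', ch N s' s - cμ N s| ≤ N := by
    intro N s
    have e1 : ∑ s', ch N s' s =
        ∑ i ∈ Finset.range N, ∑ j ∈ Finset.range N, (if f i (j + 1) = s then (1 : ℝ) else 0) := by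
      simp only [ch]
      rw [Finset.sum_comm]
      refine Finset.sum_congr rfl fun i _ => ?_
      rw [Finset.sum_comm]
      refine Finset.sum_congr rfl fun j _ => ?_
      by_cases h : f i (j + 1) = s <;> simp [h]
    rw [e1]
    let G : ℕ → ℕ → ℝ := fun a b => if f a b = s then 1 else 0
    have hG : ∀ a b, 0 ≤ G a b ∧ G a b ≤ 1 := fun a b => by simp only [G]; split_ifs <;> norm_num
    have key := abs_sum_range_shift_sub_le N G hG
    simp only [G, Nat.cast_succ] at key
    exact key
  have hcolv : ∀ N s, |∑ s', cv N s' s - cμ N s| ≤ N := by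
    intro N s
    have e1 : ∑ s', cv N s' s =
        ∑ j ∈ Finset.range N, ∑ i ∈ Finset.range N, (if f (i + 1) j = s then (1 : ℝ) else 0) := by
      simp only [cv]
      rw [Finset.sum_comm]
      refine (Finset.sum_congr rfl fun i _ => ?_).trans Finset.sum_comm
      rw [Finset.sum_comm]
      refine Finset.sum_congr rfl fun j _ => ?_
      by_cases h : f (i + 1) j = s <;> simp [h]
    have e2 : cμ N s = ∑ j ∈ Finset.range N, ∑ i ∈ Finset.range N, (if f i j = s then (1 : ℝ) else 0) :=
      Finset.sum_comm
    rw [e1, e2]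
    let G : ℕ → ℕ → ℝ := fun a b => if f b a = s then 1 else 0
    have hG : ∀ a b, 0 ≤ G a b ∧ G a b ≤ 1 := fun a b => by simp only [G]; split_ifs <;> norm_num
    have key := abs_sum_range_shift_sub_le N G hG
    simp only [G, Nat.cast_succ] at key
    exact key
  -- supports are matching pairs
  have hsupph : ∀ N s s', ch N s s' ≠ 0 → (τ s).2.1 = (τ s').2.2.2 := by
    intro N s s' h
    simp only [ch] at h
    obtain ⟨i, -, hi⟩ := Finset.exists_ne_zero_of_sum_ne_zero h
    obtain ⟨j, -, hj⟩ := Finset.exists_ne_zero_of_sum_ne_zero hi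
    by_cases hc : f i j = s ∧ f i (j + 1) = s'
    · obtain ⟨h1, h2⟩ := hc
      rw [← h1, ← h2]
      exact (hf i j).1
    · exact absurd (if_neg hc) hj
  have hsuppv : ∀ N s s', cv N s s' ≠ 0 → (τ s).2.2.1 = (τ s').1 := by
    intro N s s' h
    simp only [cv] at h
    obtain ⟨i, -, hi⟩ := Finset.exists_ne_zero_of_sum_ne_zero h
    obtain ⟨j, -, hj⟩ := Finset.exists_ne_zero_of_sum_ne_zero hi
    by_cases hc : f i j = s ∧ f (i + 1) j = s'
    · obtain ⟨h1, h2⟩ := hc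
      rw [← h1, ← h2]
      exact (hf i j).2
    · exact absurd (if_neg hc) hj
  -- bounds by the window size
  have hμle : ∀ N s, cμ N s ≤ (N : ℝ) ^ 2 := fun N s =>
    (Finset.single_le_sum (fun s' _ => hμnn N s') (Finset.mem_univ s)).trans_eq (hsumμ N)
  have hhle : ∀ N s s', ch N s s' ≤ (N : ℝ) ^ 2 := fun N s s' =>
    ((Finset.single_le_sum (fun s'' _ => hhnn N s s'') (Finset.mem_univ s')).trans_eq (hrow N s)).trans (hμle N s)
  have hvle : ∀ N s s', cv N s s' ≤ (N : ℝ) ^ 2 := fun N s s' =>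
    ((Finset.single_le_sum (fun s'' _ => hvnn N s s'') (Finset.mem_univ s')).trans_eq (hrowv N s)).trans (hμle N s)
  -- the sequence of normalised laws on the windows `[0, N+1)²`
  let Φ : ℕ → (Fin t → ℝ) × (Fin t → Fin t → ℝ) × (Fin t → Fin t → ℝ) := fun N =>
    (fun s => cμ (N + 1) s / ((N : ℝ) + 1) ^ 2,
      fun s s' => ch (N + 1) s s' / ((N : ℝ) + 1) ^ 2,
      fun s s' => cv (N + 1) s s' / ((N : ℝ) + 1) ^ 2)
  have hΦ1 : ∀ N s, (Φ N).1 s = cμ (N + 1) s / ((N : ℝ) + 1) ^ 2 := fun _ _ => rfl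
  have hΦ2 : ∀ N s s', (Φ N).2.1 s s' = ch (N + 1) s s' / ((N : ℝ) + 1) ^ 2 := fun _ _ _ => rfl
  have hΦ3 : ∀ N s s', (Φ N).2.2 s s' = cv (N + 1) s s' / ((N : ℝ) + 1) ^ 2 := fun _ _ _ => rfl
  have hMpos : ∀ N : ℕ, (0 : ℝ) < ((N : ℝ) + 1) ^ 2 := fun N => by positivity
  have hMsq : ∀ N : ℕ, (((N + 1 : ℕ) : ℝ)) ^ 2 = ((N : ℝ) + 1) ^ 2 := fun N => by push_cast; ring
  have hunit : ∀ {c : ℝ} (N : ℕ), 0 ≤ c → c ≤ (((N + 1 : ℕ) : ℝ)) ^ 2 →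
      c / ((N : ℝ) + 1) ^ 2 ∈ Set.Icc (0 : ℝ) 1 := by
    intro c N h0 h1
    rw [hMsq] at h1
    exact ⟨div_nonneg h0 (hMpos N).le, div_le_one_of_le₀ h1 (hMpos N).le⟩
  -- Bolzano–Weierstrass
  let S : Set ((Fin t → ℝ) × (Fin t → Fin t → ℝ) × (Fin t → Fin t → ℝ)) :=
    (Set.univ.pi fun _ => Set.Icc (0 : ℝ) 1) ×ˢ
      ((Set.univ.pi fun _ => Set.univ.pi fun _ => Set.Icc (0 : ℝ) 1) ×ˢ
        (Set.univ.pi fun _ => Set.univ.pi fun _ => Set.Icc (0 : ℝ) 1))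
  have hS : Bornology.IsBounded S :=
    (Bornology.IsBounded.pi fun _ => Metric.isBounded_Icc 0 1).prod
      ((Bornology.IsBounded.pi fun _ => Bornology.IsBounded.pi fun _ => Metric.isBounded_Icc 0 1).prod
        (Bornology.IsBounded.pi fun _ => Bornology.IsBounded.pi fun _ => Metric.isBounded_Icc 0 1))
  have hΦS : ∀ N, Φ N ∈ S := by
    intro N
    simp only [S, Set.mem_prod, Set.mem_univ_pi]
    refine ⟨fun s => ?_, fun s s' => ?_, fun s s' => ?_⟩
    · rw [hΦ1]; exact hunit N (hμnn _ _) (hμle _ _)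
    · rw [hΦ2]; exact hunit N (hhnn _ _ _) (hhle _ _ _)
    · rw [hΦ3]; exact hunit N (hvnn _ _ _) (hvle _ _ _)
  obtain ⟨a, -, φ, hφ, hlim⟩ := tendsto_subseq_of_bounded hS hΦS
  -- coordinate limits
  have hl1 : ∀ s, Tendsto (fun n => (Φ (φ n)).1 s) atTop (𝓝 (a.1 s)) := fun s =>
    tendsto_pi_nhds.1 ((continuous_fst.tendsto a).comp hlim) s
  have hl2 : ∀ s s', Tendsto (fun n => (Φ (φ n)).2.1 s s') atTop (𝓝 (a.2.1 s s')) := fun s s' =>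
    tendsto_pi_nhds.1 (tendsto_pi_nhds.1
      ((continuous_fst.tendsto a.2).comp ((continuous_snd.tendsto a).comp hlim)) s) s'
  have hl3 : ∀ s s', Tendsto (fun n => (Φ (φ n)).2.2 s s') atTop (𝓝 (a.2.2 s s')) := fun s s' =>
    tendsto_pi_nhds.1 (tendsto_pi_nhds.1
      ((continuous_snd.tendsto a.2).comp ((continuous_snd.tendsto a).comp hlim)) s) s'
  -- the error `1/(φ n + 1)` tends to `0`
  have herr : Tendsto (fun n => (1 : ℝ) / ((φ n : ℝ) + 1)) atTop (𝓝 0) :=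
    tendsto_one_div_add_atTop_nhds_zero_nat.comp hφ.tendsto_atTop
  -- second marginals in the limit, from the `1/N` defect
  have hmarg : ∀ (c d : ℕ → ℝ) (x y : ℝ), Tendsto (fun n => c n) atTop (𝓝 x) → Tendsto (fun n => d n) atTop (𝓝 y) →
      (∀ n, |c n - d n| ≤ 1 / ((φ n : ℝ) + 1)) → x = y := by
    intro c d x y hc hd hb
    have hsub : Tendsto (fun n => c n - d n) atTop (𝓝 (x - y)) := hc.sub hd
    have hzero : Tendsto (fun n => c n - d n) atTop (𝓝 0) :=
      squeeze_zero_norm (fun n => by rw [Real.norm_eq_abs]; exact hb n) herr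
    have := tendsto_nhds_unique hsub hzero
    linarith
  refine ⟨a.1, a.2.1, a.2.2, fun s => ?_, ?_, fun s s' => ⟨?_, ?_⟩, fun s => ⟨?_, ?_, ?_, ?_⟩, fun s s' hne => ?_,
    fun s s' hne => ?_⟩
  · -- `0 ≤ μ s`
    exact ge_of_tendsto (hl1 s) (Eventually.of_forall fun n => by
      rw [hΦ1]; exact div_nonneg (hμnn _ _) (hMpos _).le)
  · -- `∑ μ = 1`
    have hsum : Tendsto (fun n => ∑ s, (Φ (φ n)).1 s) atTop (𝓝 (∑ s, a.1 s)) :=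
      tendsto_finsetSum _ fun s _ => hl1 s
    have hone : (fun n => ∑ s, (Φ (φ n)).1 s) = fun _ => (1 : ℝ) := by
      funext n
      simp only [hΦ1]
      rw [← Finset.sum_div, hsumμ, hMsq, div_self (hMpos _).ne']
    rw [hone] at hsum
    exact (tendsto_nhds_unique hsum tendsto_const_nhds)
  · exact ge_of_tendsto (hl2 s s') (Eventually.of_forall fun n => by
      rw [hΦ2]; exact div_nonneg (hhnn _ _ _) (hMpos _).le)
  · exact ge_of_tendsto (hl3 s s') (Eventually.of_forall fun n => by
      rw [hΦ3]; exact div_nonneg (hvnn _ _ _) (hMpos _).le)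
  · -- `∑ s', ρh s s' = μ s` (exact for every window)
    have hsum : Tendsto (fun n => ∑ s', (Φ (φ n)).2.1 s s') atTop (𝓝 (∑ s', a.2.1 s s')) :=
      tendsto_finsetSum _ fun s' _ => hl2 s s'
    have heq : (fun n => ∑ s', (Φ (φ n)).2.1 s s') = fun n => (Φ (φ n)).1 s := by
      funext n
      simp only [hΦ2, hΦ1]
      rw [← Finset.sum_div, hrow]
    rw [heq] at hsum
    exact tendsto_nhds_unique hsum (hl1 s)
  · -- `∑ s', ρh s' s = μ s` (defect `≤ 1/N`)
    refine hmarg (fun n => ∑ s', (Φ (φ n)).2.1 s' s) (fun n => (Φ (φ n)).1 s) _ _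
      (tendsto_finsetSum _ fun s' _ => hl2 s' s) (hl1 s) fun n => ?_
    simp only [hΦ2, hΦ1]
    rw [← Finset.sum_div, ← sub_div, abs_div, abs_of_pos (hMpos _)]
    have hb := hcol (φ n + 1) s
    have hc : ((φ n + 1 : ℕ) : ℝ) = (φ n : ℝ) + 1 := by push_cast; ring
    rw [hc] at hb
    have hpos : (0 : ℝ) < (φ n : ℝ) + 1 := by positivity
    refine (div_le_div_of_nonneg_right hb (hMpos _).le).trans_eq ?_
    rw [sq, ← div_div, div_self hpos.ne']
  · -- `∑ s', ρv s s' = μ s`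
    have hsum : Tendsto (fun n => ∑ s', (Φ (φ n)).2.2 s s') atTop (𝓝 (∑ s', a.2.2 s s')) :=
      tendsto_finsetSum _ fun s' _ => hl3 s s'
    have heq : (fun n => ∑ s', (Φ (φ n)).2.2 s s') = fun n => (Φ (φ n)).1 s := by
      funext n
      simp only [hΦ3, hΦ1]
      rw [← Finset.sum_div, hrowv]
    rw [heq] at hsum
    exact tendsto_nhds_unique hsum (hl1 s)
  · -- `∑ s', ρv s' s = μ s`
    refine hmarg (fun n => ∑ s', (Φ (φ n)).2.2 s' s) (fun n => (Φ (φ n)).1 s) _ _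
      (tendsto_finsetSum _ fun s' _ => hl3 s' s) (hl1 s) fun n => ?_
    simp only [hΦ3, hΦ1]
    rw [← Finset.sum_div, ← sub_div, abs_div, abs_of_pos (hMpos _)]
    have hb := hcolv (φ n + 1) s
    have hc : ((φ n + 1 : ℕ) : ℝ) = (φ n : ℝ) + 1 := by push_cast; ring
    rw [hc] at hb
    have hpos : (0 : ℝ) < (φ n : ℝ) + 1 := by positivity
    refine (div_le_div_of_nonneg_right hb (hMpos _).le).trans_eq ?_
    rw [sq, ← div_div, div_self hpos.ne']
  · -- support of `ρh`
    by_contra hA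
    have hzero : ∀ n, (Φ (φ n)).2.1 s s' = 0 := by
      intro n
      rw [hΦ2]
      have : ch (φ n + 1) s s' = 0 := by
        by_contra hne'
        exact hA (hsupph _ _ _ hne')
      rw [this, zero_div]
    have hconst : Tendsto (fun n => (Φ (φ n)).2.1 s s') atTop (𝓝 0) := by
      rw [show (fun n => (Φ (φ n)).2.1 s s') = fun _ => (0 : ℝ) from funext hzero]
      exact tendsto_const_nhds
    exact hne (tendsto_nhds_unique (hl2 s s') hconst)
  · -- support of `ρv`
    by_contra hA
    have hzero : ∀ n, (Φ (φ n)).2.2 s s' = 0 := by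
      intro n
      rw [hΦ3]
      have : cv (φ n + 1) s s' = 0 := by
        by_contra hne'
        exact hA (hsuppv _ _ _ hne')
      rw [this, zero_div]
    have hconst : Tendsto (fun n => (Φ (φ n)).2.2 s s') atTop (𝓝 0) := by
      rw [show (fun n => (Φ (φ n)).2.2 s s') = fun _ => (0 : ℝ) from funext hzero]
      exact tendsto_const_nhds
    exact hne (tendsto_nhds_unique (hl3 s s') hconst)

end Summit.PneNP.PneNP.Theorems
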